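/-
Copyright (c) 2026 the pub-hodgecm-mathlib formalisation cell (harness21).  Prover seat hodgecm-mathlib-K2E3-p31 (g3) on LEAD F0P6-plan (g15) BATCH #239
(U1 desk K2E3-p28 (g3); END pen K2E3-p32 (g3)), Track B «K2-LIT» ∕ hLiu418 #184♮ = `stmt-HodgeConjecture-24832`, organ U1-CT-ind stage 3 («U1-glob») LEVEL 2:
THE LAST BY-VALUE ARCHIMEDEAN LETTER `hAint` OF ★ p864130 (F-split) `K2LiuLocalKernelHeadSplitAtKernelPlace.exists_headSplit_kernelPlace` :107–:117, DISCHARGED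
for Hecke characters of unitary archimedean type `(t, 0)` — by ★ `K2LiuKindOneArchLetterIntegrable` §1 (K2Liu-p03 (g8); engine ★ K2Liu-p11 (g5) lineage) at the trivial
index `S' = 0` (★ `unipDeltaChar_zero`).  THEOREMS ONLY (no `def`, no `instance`, no notation, no named-fact hypothesis, no `sorry`, default heartbeats).
-/
import Summits.HodgeConjecture.HodgeConjecture.Theorems.K2LiuKindOneArchLetterIntegrable   -- ★ (K1a-T-arch) §1 `integrable_conj_unipDeltaChar_mul_of_archLetters` (K2Liu-p03; engine ★ K2Liu-p11 Bridge §1)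
import HarnessLib

/-!
# Crux `HLiu418`, U1-glob LEVEL 2 — `K2LiuLocalKernelArchIntegrableOfKType`: THE ARCHIMEDEAN FLAT BLOCK `p ↦ H_{𝒦″}((w_Δ)_∞·p·x)^{2(s−s₀)} · A((w_Δ)_∞·p·x)`
# OF A `K″_∞`-FINITE SIEGEL-`χ^{s₀}`-EQUIVARIANT CONTINUOUS `A` IS `ν_∞`-INTEGRABLE ON `N_Δ(L⁺⊗ℝ)` FOR `1 < re s` — the `hAint` letter of ★ p864130, unconditionally in `A`

Cell `hodgecm-mathlib`, crux item hLiu418 = `stmt-HodgeConjecture-24832` (helper lane `--supports … --as helper`, count-neutral; closes no socket), route of record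
`HCCMUnconditional`; squad K2, strike line L1, organ U1-glob LEVEL 2.  CONSUMER: U1-glob END pen K2E3-p32 (g3), ED. 2 of ★ FILE B `K2LiuLocalKernelResidueVanishes`
(`…_of_headSplit`), whose call of ★ p864130 `exists_headSplit_kernelPlace` (U1 desk K2E3-p28 (g3)) binds
`hAint := fun 𝒦'' h𝒦'' A hAs hAf hAc νinf _ _ x s hs => …` — the ARCHIMEDEAN INTEGRABILITY LETTER, ∀-closed over standard data `𝒦″`, (E6′) arch data `(A, hAs, hAf, hAc)`,
Haar carriers `ν_∞`, arch translates `x` and `1 < re s` (★ p864130 :107–:117; the integrability half of the (β)-END `hArch` shape of ★ `K2LiuBigCellContinuation`).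

THE POINT.  ★ `K2LiuKindOneArchLetterIntegrable.integrable_conj_unipDeltaChar_mul_of_archLetters` (K2Liu-p03 (g8); road = ★ K2Liu-p11 (g5)
`K2LiuKindWArchLetterIntegrableBridge` §1∕§3: tube frames ★ arch₄, reading frames, the frame-compact conjugator ★ FILE 21, the flat tube presentation ★ FILE 18, and the
Γ₂ ∕ Siegel–Gindikin majorant of ★ FILE A §5) ALREADY proves, for a standard `𝒦′`, `χ` of unitary archimedean type `(t, 0)`, `s₀`, and ONE arch factor `A₁` carrying EXACTLY
★ p864130's three clauses (`hAlaw` = `hAs` the finPart-form Siegel law at `s₀`, `hfin` = `hAf` the `K′_∞`-finiteness, `hAc` continuity): for EVERY Haar `ν`, EVERY index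
`S′ ∈ M₂(L)`, EVERY right factor `hpt` and `½ < re s`, `a ↦ conj ψ_{S′}(ι_∞ a) · (H_{𝒦′}((w_Δ)_∞·a·hpt)^{2(s−s₀)} · A₁((w_Δ)_∞·a·hpt))` is `ν`-integrable.  ★ p864130's letter is
the case `S′ := 0` (`ψ_0 ≡ 1`, ★ `unipDeltaChar_zero`), `hpt := x`, `½ < 1 < re s`.  So the gap is RE-KEYING (S), no new analysis:
* §1 **`integrable_heightTwist_mul_of_archLetters`** — ONE standard datum, ONE factor: ★ §1 at `S′ = 0`, the unit weight erased by `Integrable.congr`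
  (`simp only [unipDeltaChar_zero, Circle.coe_one, map_one, one_mul]`), `½ < re s`.
* §2 **`hAint_of_archKType`** — ★ p864130 :107–:117's `hAint` binder BYTES VERBATIM as the conclusion, from `(hdV0, hdW0, ht, s₀)` only: `intro 𝒦'' h𝒦'' A hAs hAf hAc νinf _ _ x s hs`,
  §1 at `1/2 < 1 < re s`.  At the tie (p32 ED. 2): `hAint := hAint_of_archKType L e dV hdV dW hdW hdV0 hdW0 ht s₀`.
ONE binder the letter's closure does not carry: `ht : χ.HasUnitaryArchType t 0` (a property of the FIXED `χ`, outside the ∀-closure; in the road of record `χ` is the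
HKS splitting character, ★ `IsSplittingChar.exists_hasUnitaryArchType` ∕ ★ `exists_hasUnitaryArchType_two_mul` supply `t` from `χ.IsUnitary` + splitting).
Generic in the CM field `L`, the rank-`2` doubled frame `(e : Fin N₀ × Fin M₀ ≃ Fin 2, dV, dW)` (★ §1's currency = ★ p864130's), `χ`, `t`, `s₀`.
HONEST LABEL.  Count-neutral helper (no new mathematics: ★ K2Liu-p03 ∕ K2Liu-p11 lineage's engine, re-addressed at the trivial index); it closes no socket: `HC_CM` is
proved only modulo the 7 printed citations (2 remaining named inputs: hLiu418 = `stmt-HodgeConjecture-24832`, h413 = `stmt-HodgeConjecture-24833`) until rung 0 closes.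

## References
* [Shimura1997] G. Shimura, *Euler Products and Eisenstein Series*, CBMS 93 (1997), §16.4, §18.4 (archimedean factors; absolute convergence of the intertwining integral).
* [KudlaRallis1994] S. Kudla, S. Rallis, Ann. of Math. 140 (1994), §1–§2 (Euler factorisation of the Fourier coefficients of Siegel Eisenstein series).
* [Tan1999] V. Tan, *Poles of Siegel Eisenstein series on U(n,n)*, Canad. J. Math. 51 (1999), §1 p. 166, §3 (standard sections `Φ_∞ ⊗ Φ_f`).
* [BorelJacquet1979] A. Borel, H. Jacquet, Proc. Symp. Pure Math. 33 (1979), §4.1 (archimedean components, `K_∞`-finite vectors).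
-/

set_option autoImplicit false
set_option linter.dupNamespace false -- the mandated namespace repeats `HodgeConjecture.HodgeConjecture`

noncomputable section

open scoped Matrix ComplexConjugate NNReal Classical
open Complex Matrix MeasureTheory MeasureTheory.Measure NumberField NumberField.InfinitePlace IsDedekindDomain
open Literature.NumberTheory.Automorphic Literature.NumberTheory.Automorphic.UnitaryGroup Literature.NumberTheory.GaloisRepresentations
open Literature.NumberTheory.GelbartRogawski1991 Literature.NumberTheory.GelbartRogawski1991.GRConstruction
open Literature.NumberTheory.GelbartRogawski1991.UnitaryDualPair
open Literature.NumberTheory.K2Lit.SiegelDoubled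

namespace Summit.HodgeConjecture.HodgeConjecture.Cruxes.HLiu418.K2LiuLocalKernelArchIntegrableOfKType

open K2LiuSiegelUnipotentLocalDefs
open K2LiuSiegelUnipotentFourierDefs (unipDeltaChar unipDeltaChar_zero)
open K2LiuKindOneArchLetterIntegrable (integrable_conj_unipDeltaChar_mul_of_archLetters)

variable (L : Type) [Field L] [NumberField L] [IsCMField L]
variable {N₀ M₀ : ℕ} (e : Fin N₀ × Fin M₀ ≃ Fin 2)
  (dV : Fin N₀ → L) (hdV : ∀ i, IsCMField.complexConj L (dV i) = dV i)
  (dW : Fin M₀ → L) (hdW : ∀ i, IsCMField.complexConj L (dW i) = dW i)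
  [MeasurableSpace ↥(unipDeltaArch L e dV hdV dW hdW)] [BorelSpace ↥(unipDeltaArch L e dV hdV dW hdW)]

/-! ## §1 One standard datum, one archimedean factor: the height-twisted flat block is integrable at every Haar carrier and every translate -/

/-- **§1 THE HEIGHT-TWISTED ARCHIMEDEAN FLAT BLOCK OF A STANDARD DATUM IS `ν`-INTEGRABLE.**  `𝒦′` standard, `χ` of unitary archimedean type `(t, 0)` (`ht`), `s₀`, ONE
archimedean factor `A₁ : H_∞ → ℂ` with ★ p864130's three (E6′) arch clauses VERBATIM (`hAlaw` the finPart-form Siegel law at `s₀`, `hfin` `K′_∞`-finiteness, `hAc` continuity).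
THEN for EVERY Haar measure `ν` on `N_Δ(L⁺⊗ℝ)`, EVERY right factor `hpt ∈ H_∞` and `½ < re s`:
`Integrable (a ↦ H_{𝒦′}((w_Δ)_∞·a·hpt)^{2(s−s₀)} · A₁((w_Δ)_∞·a·hpt)) ν` — ★ `K2LiuKindOneArchLetterIntegrable.integrable_conj_unipDeltaChar_mul_of_archLetters` at the trivial
index `S′ := 0`, where the weight `conj ψ_0(ι_∞ a) = 1` (★ `unipDeltaChar_zero`) is erased by `Integrable.congr`.
[cite: Shimura1997, §16.4, §18.4] [cite: KudlaRallis1994, §1–§2] [cite: Tan1999, §1, §3] [cite: BorelJacquet1979, §4.1] -/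
theorem integrable_heightTwist_mul_of_archLetters (hdV0 : ∀ i, dV i ≠ 0) (hdW0 : ∀ i, dW i ≠ 0)
    {χ : HeckeCharacter L} {t : InfinitePlace L → ℤ} (ht : χ.HasUnitaryArchType t 0)
    (𝒦' : IwasawaDatum L e dV hdV dW hdW) (h𝒦' : 𝒦'.IsStd) (s₀ : ℂ)
    {A₁ : UnitaryGroup.arch (Fp L) L (IsCMField.complexConj L) (2 + 2) (hermD L e dV hdV dW hdW) → ℂ}
    (hAlaw : ∀ p : HA L e dV hdV dW hdW, IsSiegelDelta L e dV hdV dW hdW p → UnitaryGroup.finPart (Fp L) L (IsCMField.complexConj L) (2 + 2) (hermD L e dV hdV dW hdW) p = 1 →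
      ∀ x : UnitaryGroup.arch (Fp L) L (IsCMField.complexConj L) (2 + 2) (hermD L e dV hdV dW hdW),
        A₁ (UnitaryGroup.archPart (Fp L) L (IsCMField.complexConj L) (2 + 2) (hermD L e dV hdV dW hdW) p * x) = siegelDeltaCharacter L e dV hdV dW hdW χ s₀ p * A₁ x)
    (hfin : ∃ V : Submodule ℂ (UnitaryGroup.arch (Fp L) L (IsCMField.complexConj L) (2 + 2) (hermD L e dV hdV dW hdW) → ℂ), FiniteDimensional ℂ V ∧ A₁ ∈ V ∧
      ∀ a₀ : UnitaryGroup.arch (Fp L) L (IsCMField.complexConj L) (2 + 2) (hermD L e dV hdV dW hdW),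
        (UnitaryGroup.archToAdelic (Fp L) L (IsCMField.complexConj L) (2 + 2) (hermD L e dV hdV dW hdW) a₀ : HA L e dV hdV dW hdW) ∈ 𝒦'.K → ∀ G ∈ V, (fun x => G (x * a₀)) ∈ V)
    (hAc : Continuous A₁)
    (ν : Measure ↥(unipDeltaArch L e dV hdV dW hdW)) [ν.IsHaarMeasure]
    (hpt : UnitaryGroup.arch (Fp L) L (IsCMField.complexConj L) (2 + 2) (hermD L e dV hdV dW hdW)) {s : ℂ} (hs : 1 / 2 < s.re) :
    Integrable (fun a : ↥(unipDeltaArch L e dV hdV dW hdW) =>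
      ((modDelta L e dV hdV dW hdW (𝒦'.pPart (UnitaryGroup.archToAdelic (Fp L) L (IsCMField.complexConj L) (2 + 2) (hermD L e dV hdV dW hdW)
          (UnitaryGroup.archPart (Fp L) L (IsCMField.complexConj L) (2 + 2) (hermD L e dV hdV dW hdW) (weylDelta L e dV hdV dW hdW) *
            (a : UnitaryGroup.arch (Fp L) L (IsCMField.complexConj L) (2 + 2) (hermD L e dV hdV dW hdW)) * hpt))) : ℝ) : ℂ) ^ (2 * (s - s₀)) *
        A₁ (UnitaryGroup.archPart (Fp L) L (IsCMField.complexConj L) (2 + 2) (hermD L e dV hdV dW hdW) (weylDelta L e dV hdV dW hdW) *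
            (a : UnitaryGroup.arch (Fp L) L (IsCMField.complexConj L) (2 + 2) (hermD L e dV hdV dW hdW)) * hpt)) ν := by
  refine (integrable_conj_unipDeltaChar_mul_of_archLetters L e dV hdV dW hdW hdV0 hdW0 ht 𝒦' h𝒦' s₀ hAlaw hfin hAc ν 0 hpt hs).congr
    (Filter.Eventually.of_forall fun a => ?_)
  simp only [unipDeltaChar_zero, Circle.coe_one, map_one, one_mul]

/-! ## §2 The `hAint` letter of ★ p864130 `exists_headSplit_kernelPlace`, verbatim -/

/-- **§2 THE ARCHIMEDEAN INTEGRABILITY LETTER `hAint` OF ★ p864130 (F-split), DISCHARGED.**  Inputs: `dV dW` non-zero, `χ` of unitary archimedean type `(t, 0)` (`ht`), `s₀`.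
THEN ★ `K2LiuLocalKernelHeadSplitAtKernelPlace.exists_headSplit_kernelPlace` :107–:117's binder BYTES: for every standard datum `𝒦″`, every archimedean factor `A : H_∞ → ℂ` with
the three (E6′) arch clauses (finPart-form Siegel `χ^{s₀}`-law, `K″_∞`-finiteness, continuity), every Haar σ-finite carrier `ν_∞` on `N_Δ(L⁺⊗ℝ)`, every arch translate `x` and
every `s` with `1 < re s`, `Integrable (p ↦ H_{𝒦″}((w_Δ)_∞·p·x)^{2(s−s₀)} · A((w_Δ)_∞·p·x)) ν_∞` — §1 at `½ < 1 < re s`.  At the tie: `hAint := hAint_of_archKType L e dV hdV dW hdW hdV0 hdW0 ht s₀`.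
[cite: Shimura1997, §16.4, §18.4] [cite: KudlaRallis1994, §1–§2] [cite: Tan1999, §1, §3] [cite: BorelJacquet1979, §4.1] -/
theorem hAint_of_archKType (hdV0 : ∀ i, dV i ≠ 0) (hdW0 : ∀ i, dW i ≠ 0)
    {χ : HeckeCharacter L} {t : InfinitePlace L → ℤ} (ht : χ.HasUnitaryArchType t 0) (s₀ : ℂ) :
    ∀ (𝒦'' : IwasawaDatum L e dV hdV dW hdW), 𝒦''.IsStd →
      ∀ (A : UnitaryGroup.arch (Fp L) L (IsCMField.complexConj L) (2 + 2) (hermD L e dV hdV dW hdW) → ℂ),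
        (∀ p : HA L e dV hdV dW hdW, GRConstruction.IsSiegelDelta L e dV hdV dW hdW p → UnitaryGroup.finPart (Fp L) L (IsCMField.complexConj L) (2 + 2) (hermD L e dV hdV dW hdW) p = 1 →
          ∀ x : UnitaryGroup.arch (Fp L) L (IsCMField.complexConj L) (2 + 2) (hermD L e dV hdV dW hdW), A (UnitaryGroup.archPart (Fp L) L (IsCMField.complexConj L) (2 + 2) (hermD L e dV hdV dW hdW) p * x) = siegelDeltaCharacter L e dV hdV dW hdW χ s₀ p * A x) →
        (∃ V : Submodule ℂ (UnitaryGroup.arch (Fp L) L (IsCMField.complexConj L) (2 + 2) (hermD L e dV hdV dW hdW) → ℂ), FiniteDimensional ℂ V ∧ A ∈ V ∧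
          ∀ a₀ : UnitaryGroup.arch (Fp L) L (IsCMField.complexConj L) (2 + 2) (hermD L e dV hdV dW hdW), (UnitaryGroup.archToAdelic (Fp L) L (IsCMField.complexConj L) (2 + 2) (hermD L e dV hdV dW hdW) a₀ : HA L e dV hdV dW hdW) ∈ 𝒦''.K → ∀ G ∈ V, (fun x => G (x * a₀)) ∈ V) →
        Continuous A →
        ∀ (νinf : Measure ↥(unipDeltaArch L e dV hdV dW hdW)) [νinf.IsHaarMeasure] [SigmaFinite νinf] (x : UnitaryGroup.arch (Fp L) L (IsCMField.complexConj L) (2 + 2) (hermD L e dV hdV dW hdW)) (s : ℂ), 1 < s.re →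
          Integrable (fun p : ↥(unipDeltaArch L e dV hdV dW hdW) =>
            ((modDelta L e dV hdV dW hdW (𝒦''.pPart (UnitaryGroup.archToAdelic (Fp L) L (IsCMField.complexConj L) (2 + 2) (hermD L e dV hdV dW hdW) (UnitaryGroup.archPart (Fp L) L (IsCMField.complexConj L) (2 + 2) (hermD L e dV hdV dW hdW) (weylDelta L e dV hdV dW hdW) * (p : UnitaryGroup.arch (Fp L) L (IsCMField.complexConj L) (2 + 2) (hermD L e dV hdV dW hdW)) * x))) : ℝ) : ℂ) ^ (2 * (s - s₀)) *
              A (UnitaryGroup.archPart (Fp L) L (IsCMField.complexConj L) (2 + 2) (hermD L e dV hdV dW hdW) (weylDelta L e dV hdV dW hdW) * (p : UnitaryGroup.arch (Fp L) L (IsCMField.complexConj L) (2 + 2) (hermD L e dV hdV dW hdW)) * x)) νinf := by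
  intro 𝒦'' h𝒦'' A hAs hAf hAc νinf _ _ x s hs
  have hs' : 1 / 2 < s.re := by linarith
  exact integrable_heightTwist_mul_of_archLetters L e dV hdV dW hdW hdV0 hdW0 ht 𝒦'' h𝒦'' s₀ hAs hAf hAc νinf x hs'

end Summit.HodgeConjecture.HodgeConjecture.Cruxes.HLiu418.K2LiuLocalKernelArchIntegrableOfKType

end
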